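import Literature.Analysis.FluidPDE.KNSSLiouvilleBridge
import Literature.Analysis.FluidPDE.TypeIAncientMild
import Literature.Analysis.FluidPDE.SolenoidalL2Duality
import HarnessLib

/-!
# `SphereTangentLiouville`, II: from almost every slice to every slice

Support file for item `stmt-NavierStokesRegularity-1365` (route `CorkscrewDynamo`,
NavierStokesRegularity). The representative `V` of part I agrees with the duality-form solution
`v` on a.e. slice and is tangent to the spheres on a.e. slice; both statements are upgraded to
EVERY `t < 0`:

* `eq_zero_of_ae_inner_eq_zero` — a vector orthogonal to a.e. `x` is zero;
* `continuousOn_integral_inner_of_time_lipschitz` — pairings `t ↦ ∫⟪V(t), θ⟫` of a bounded family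
  with continuous slices and `‖V(t,x) − V(s,x)‖ ≤ L(‖x‖+3)|t−s|` against a continuous compactly
  supported `θ` are continuous on `(−∞, 0)` (dominated convergence);
* `forall_tangent_of_ae` — tangency at every `t < 0` (continuity in time);
* `ae_eq_slice_of_ae` — `v(t) = V(t)` a.e. for EVERY `t < 0`: the pairings of `v` with
  divergence-free tests are continuous in time (`IsBoundedAncientMildSolution.continuousOn_integral_inner`),
  so `v(t) − V(t)` annihilates them; being bounded and weakly divergence free it is a.e. a constant
  (`IsWeaklyDivFree.exists_ae_eq_const_of_norm_le_of_forall_integral_inner_eq_zero`), and tangency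
  of both fields kills the constant.
-/

noncomputable section

open MeasureTheory Set Function Filter InnerProductSpace Metric
open scoped RealInnerProductSpace Topology
open Literature.Analysis Literature.Analysis.FluidPDE

set_option linter.dupNamespace false

namespace Summit.NavierStokesRegularity.NavierStokesRegularity.Theorems

/-- A vector orthogonal to almost every `x` is zero (the failure set is open and contains the
vector itself). -/
theorem eq_zero_of_ae_inner_eq_zero {E : Type*} [NormedAddCommGroup E] [InnerProductSpace ℝ E]
    [FiniteDimensional ℝ E] [MeasurableSpace E] [BorelSpace E]
    {c : E} (h : ∀ᵐ x ∂(volume : Measure E), ⟪x, c⟫ = 0) : c = 0 := by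
  by_contra hc
  have hopen : IsOpen {x : E | ⟪x, c⟫ ≠ 0} :=
    isOpen_ne_fun (continuous_id.inner continuous_const) continuous_const
  have hne : ({x : E | ⟪x, c⟫ ≠ 0}).Nonempty :=
    ⟨c, by simpa [real_inner_self_eq_norm_sq] using hc⟩
  have hpos : 0 < volume {x : E | ⟪x, c⟫ ≠ 0} := hopen.measure_pos volume hne
  have hnull : volume {x : E | ¬ ⟪x, c⟫ = 0} = 0 := ae_iff.1 h
  exact hpos.ne' hnull

/-- **Pairings of a time-Lipschitz bounded family with a compactly supported continuous field are
continuous in time.** -/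
theorem continuousOn_integral_inner_of_time_lipschitz
    {V : ℝ → EuclideanSpace ℝ (Fin 3) → EuclideanSpace ℝ (Fin 3)} {M L : ℝ}
    (hVc : ∀ t < 0, Continuous (V t)) (hVM : ∀ t < 0, ∀ x, ‖V t x‖ ≤ M)
    (hVlip : ∀ s < 0, ∀ t < 0, ∀ x, ‖V t x - V s x‖ ≤ L * (‖x‖ + 3) * |t - s|)
    {θ : EuclideanSpace ℝ (Fin 3) → EuclideanSpace ℝ (Fin 3)} (hθ : Continuous θ)
    (hθc : HasCompactSupport θ) :
    ContinuousOn (fun t => ∫ x, ⟪V t x, θ x⟫) (Iio 0) := by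
  intro t₀ ht₀
  have ht₀' : t₀ < 0 := ht₀
  have hev : ∀ᶠ t in 𝓝 t₀, t < 0 := isOpen_Iio.mem_nhds ht₀'
  refine (continuousAt_of_dominated (bound := fun x => M * ‖θ x‖) ?_ ?_ ?_ ?_).continuousWithinAt
  · filter_upwards [hev] with t ht
    exact ((hVc t ht).inner hθ).aestronglyMeasurable
  · filter_upwards [hev] with t ht
    refine Eventually.of_forall fun x => ?_
    rw [Real.norm_eq_abs]
    exact (abs_real_inner_le_norm _ _).trans (mul_le_mul_of_nonneg_right (hVM t ht x) (norm_nonneg _))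
  · exact (hθ.norm.integrable_of_hasCompactSupport hθc.norm).const_mul M
  · refine Eventually.of_forall fun x => ?_
    have hcV : ContinuousAt (fun t => V t x) t₀ := by
      rw [Metric.continuousAt_iff]
      intro ε hε
      set K : ℝ := |L| * (‖x‖ + 3) + 1 with hK
      have hK0 : 0 < K := by positivity
      refine ⟨min (ε / K) (-t₀), lt_min (div_pos hε hK0) (by linarith), fun t ht => ?_⟩
      have ht1 : |t - t₀| < ε / K := lt_of_lt_of_le ht (min_le_left _ _)
      have ht2 : |t - t₀| < -t₀ := lt_of_lt_of_le ht (min_le_right _ _)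
      have htneg : t < 0 := by
        have := (abs_lt.1 ht2).2
        linarith
      rw [dist_eq_norm]
      calc ‖V t x - V t₀ x‖ ≤ L * (‖x‖ + 3) * |t - t₀| := hVlip t₀ ht₀' t htneg x
        _ ≤ K * |t - t₀| := by
            refine mul_le_mul_of_nonneg_right ?_ (abs_nonneg _)
            have : L * (‖x‖ + 3) ≤ |L| * (‖x‖ + 3) :=
              mul_le_mul_of_nonneg_right (le_abs_self L) (by positivity)
            linarith
        _ < K * (ε / K) := mul_lt_mul_of_pos_left ht1 hK0
        _ = ε := by field_simp
    exact hcV.inner continuousAt_const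

/-- **Tangency at every `t < 0`** from tangency at a.e. `t < 0`, for a family continuous in time
in the sense `‖V(t,x) − V(s,x)‖ ≤ L(‖x‖+3)|t−s|`. -/
theorem forall_tangent_of_ae
    {V : ℝ → EuclideanSpace ℝ (Fin 3) → EuclideanSpace ℝ (Fin 3)} {L : ℝ}
    (hVlip : ∀ s < 0, ∀ t < 0, ∀ x, ‖V t x - V s x‖ ≤ L * (‖x‖ + 3) * |t - s|)
    (hae : ∀ᵐ t ∂((volume : Measure ℝ).restrict (Iio 0)), ∀ x, ⟪x, V t x⟫ = 0) :
    ∀ t < 0, ∀ x, ⟪x, V t x⟫ = 0 := by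
  intro t ht x
  have hcont : ContinuousOn (fun s => ⟪x, V s x⟫) (Iio 0) := by
    intro s₀ hs₀
    have hs₀' : s₀ < 0 := hs₀
    refine (continuousAt_const.inner ?_).continuousWithinAt
    rw [Metric.continuousAt_iff]
    intro ε hε
    set K : ℝ := |L| * (‖x‖ + 3) + 1 with hK
    have hK0 : 0 < K := by positivity
    refine ⟨min (ε / K) (-s₀), lt_min (div_pos hε hK0) (by linarith), fun s hs => ?_⟩
    have hs1 : |s - s₀| < ε / K := lt_of_lt_of_le hs (min_le_left _ _)
    have hs2 : |s - s₀| < -s₀ := lt_of_lt_of_le hs (min_le_right _ _)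
    have hsneg : s < 0 := by
      have := (abs_lt.1 hs2).2
      linarith
    rw [dist_eq_norm]
    calc ‖V s x - V s₀ x‖ ≤ L * (‖x‖ + 3) * |s - s₀| := hVlip s₀ hs₀' s hsneg x
      _ ≤ K * |s - s₀| := by
          refine mul_le_mul_of_nonneg_right ?_ (abs_nonneg _)
          have : L * (‖x‖ + 3) ≤ |L| * (‖x‖ + 3) :=
            mul_le_mul_of_nonneg_right (le_abs_self L) (by positivity)
          linarith
      _ < K * (ε / K) := mul_lt_mul_of_pos_left hs1 hK0
      _ = ε := by field_simp
  have hae' : (fun s => ⟪x, V s x⟫) =ᵐ[(volume : Measure ℝ).restrict (Iio 0)] fun _ => (0 : ℝ) := by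
    filter_upwards [hae] with s hs
    exact hs x
  exact Measure.eqOn_open_of_ae_eq hae' isOpen_Iio hcont continuousOn_const ht

/-- **`v(t) = V(t)` a.e. for every `t < 0`.** Let `v` be a bounded ancient mild solution (duality
form, `ν = 1`, measurable slices) tangent to the spheres about the origin, and `V` a family with
continuous bounded slices, `C¹` and divergence free, tangent to the spheres, continuous in time in
the sense `‖V(t,x) − V(s,x)‖ ≤ L(‖x‖+3)|t−s|`, with `v(t) = V(t)` a.e. for a.e. `t < 0`. Then
`v(t) = V(t)` a.e. for every `t < 0`. -/
theorem ae_eq_slice_of_ae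
    {v V : ℝ → EuclideanSpace ℝ (Fin 3) → EuclideanSpace ℝ (Fin 3)} {M L : ℝ}
    (hv : IsBoundedAncientMildSolution 1 v) (hmeas : ∀ t < 0, AEStronglyMeasurable (v t) volume)
    (htan : ∀ t < 0, ∀ x, ⟪x, v t x⟫ = 0)
    (hV1 : ∀ t < 0, ContDiff ℝ 1 (V t)) (hVdiv : ∀ t < 0, VectorCalculus.IsDivFree (V t))
    (hVM : ∀ t < 0, ∀ x, ‖V t x‖ ≤ M)
    (hVlip : ∀ s < 0, ∀ t < 0, ∀ x, ‖V t x - V s x‖ ≤ L * (‖x‖ + 3) * |t - s|)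
    (hVtan : ∀ t < 0, ∀ x, ⟪x, V t x⟫ = 0)
    (hae : ∀ᵐ t ∂((volume : Measure ℝ).restrict (Iio 0)), v t =ᵐ[volume] V t) :
    ∀ t < 0, v t =ᵐ[volume] V t := by
  intro t₀ ht₀
  obtain ⟨Mv, hMv⟩ := hv.2
  have hMv' : ∀ t < 0, ∀ x, ‖v t x‖ ≤ Mv := fun t ht x => hMv t ht x
  have hVc : ∀ t < 0, Continuous (V t) := fun t ht => (hV1 t ht).continuous
  -- the pairings with divergence-free tests agree at `t₀`
  have hpair : ∀ φ : EuclideanSpace ℝ (Fin 3) → EuclideanSpace ℝ (Fin 3),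
      FunctionSpaces.IsTestFunctionOn (⊤ : TopologicalSpace.Opens (EuclideanSpace ℝ (Fin 3))) φ →
      VectorCalculus.IsDivFree φ → ∫ x, ⟪v t₀ x, φ x⟫ = ∫ x, ⟪V t₀ x, φ x⟫ := by
    intro φ hφ hdiv
    have h1 : ContinuousOn (fun t => ∫ x, ⟪v t x, φ x⟫) (Iio 0) :=
      hv.continuousOn_integral_inner one_pos hmeas hφ hdiv
    have h2 : ContinuousOn (fun t => ∫ x, ⟪V t x, φ x⟫) (Iio 0) :=
      continuousOn_integral_inner_of_time_lipschitz hVc hVM hVlip hφ.contDiff.continuous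
        hφ.hasCompactSupport
    have h3 : (fun t => ∫ x, ⟪v t x, φ x⟫) =ᵐ[(volume : Measure ℝ).restrict (Iio 0)]
        fun t => ∫ x, ⟪V t x, φ x⟫ := by
      filter_upwards [hae] with t ht
      refine integral_congr_ae ?_
      filter_upwards [ht] with x hx
      rw [hx]
    exact Measure.eqOn_open_of_ae_eq h3 isOpen_Iio h1 h2 ht₀
  -- the difference is bounded, weakly divergence free, and annihilates divergence-free tests
  set w : EuclideanSpace ℝ (Fin 3) → EuclideanSpace ℝ (Fin 3) := fun x => v t₀ x - V t₀ x with hw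
  have hwm : AEStronglyMeasurable w volume :=
    (hmeas t₀ ht₀).sub (hVc t₀ ht₀).aestronglyMeasurable
  have hwb : ∀ x, ‖w x‖ ≤ Mv + M := fun x =>
    (norm_sub_le _ _).trans (add_le_add (hMv' t₀ ht₀ x) (hVM t₀ ht₀ x))
  have hvli : LocallyIntegrable (v t₀) volume :=
    (memLp_top_of_bound (hmeas t₀ ht₀) Mv (Eventually.of_forall (hMv' t₀ ht₀))).locallyIntegrable
      le_top
  have hVli : LocallyIntegrable (V t₀) volume := (hVc t₀ ht₀).locallyIntegrable
  have hwdiv : IsWeaklyDivFree w :=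
    (hv.1.1 t₀ ht₀).sub_of_locallyIntegrable
      (VectorCalculus.IsDivFree.isWeaklyDivFree_holds (hVdiv t₀ ht₀) (hV1 t₀ ht₀)) hvli hVli
  have hwann : ∀ φ : EuclideanSpace ℝ (Fin 3) → EuclideanSpace ℝ (Fin 3),
      FunctionSpaces.IsTestFunctionOn (⊤ : TopologicalSpace.Opens (EuclideanSpace ℝ (Fin 3))) φ →
      VectorCalculus.IsDivFree φ → ∫ x, ⟪w x, φ x⟫ = 0 := by
    intro φ hφ hdiv
    have hφc : Continuous φ := hφ.contDiff.continuous
    have i1 : Integrable (fun x => ⟪v t₀ x, φ x⟫) (volume : Measure (EuclideanSpace ℝ (Fin 3))) :=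
      integrable_inner_of_norm_le_of_hasCompactSupport (hmeas t₀ ht₀) (hMv' t₀ ht₀) hφc
        hφ.hasCompactSupport
    have i2 : Integrable (fun x => ⟪V t₀ x, φ x⟫) (volume : Measure (EuclideanSpace ℝ (Fin 3))) :=
      integrable_inner_of_continuous_of_hasCompactSupport (hVc t₀ ht₀) hφc hφ.hasCompactSupport
    simp only [hw, inner_sub_left]
    rw [integral_sub i1 i2, hpair φ hφ hdiv, sub_self]
  obtain ⟨c, hc⟩ :=
    IsWeaklyDivFree.exists_ae_eq_const_of_norm_le_of_forall_integral_inner_eq_zero hwm hwb hwdiv hwann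
  -- tangency kills the constant
  have hc0 : c = 0 := by
    refine eq_zero_of_ae_inner_eq_zero ?_
    filter_upwards [hc] with x hx
    rw [← hx, hw]
    simp only [inner_sub_right, htan t₀ ht₀ x, hVtan t₀ ht₀ x, sub_self]
  rw [hc0] at hc
  filter_upwards [hc] with x hx
  have : v t₀ x - V t₀ x = 0 := hx
  exact sub_eq_zero.1 this

end Summit.NavierStokesRegularity.NavierStokesRegularity.Theorems
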